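import Mathlib
import Literature.RingTheory.CohomologyAnnihilator.ReductionModRegular
import Literature.RingTheory.CohomologyAnnihilator.StableAnnihilation
import Literature.RingTheory.CohomologyAnnihilator.SyzygyDescent
import Literature.RingTheory.CohomologyAnnihilator.Localization
import Summits.ResolutionOfSingularities.ResolutionOfSingularities.Theorems.HomologicalConductorNoZenoStableAnnihilatorReduction
import Summits.ResolutionOfSingularities.ResolutionOfSingularities.Theorems.HomologicalConductorPersistenceQuotientAscent
import HarnessLib

/-!
# Rung S-2 `PersistenceSurface` (stmt-ResolutionOfSingularities-19970) — QUOTIENT ASCENT IN CODIMENSION TWO,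
# part 1 (lemmas): connecting maps after multiplication maps, retract sums, Knörrer's lemma with the complement

Route `ResolutionOfSingularities/HomologicalConductor`, chain W4.4b (cell res-hironaka; seat res-L1-w44b-stub-1
gen 6, lead-1 WAVE-3 row «arena cells (C2 kernel side)»). `[OURS · L1 w44b]` replaces the role of no printed item;
NOT a statement of the manuscript under review (Hironaka 2017), nothing here is attributed to its author; folklore
homological algebra, AI-written (weaker than expert review).

## Why

Part 2 (`…PersistenceQuotientAscentCodimTwo`) proves: `R` noetherian, `a ∈ R⁰`, `b̄ ∈ (R ⧸ (a))⁰`,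
`a, b ∈ caᵐ⁺³(R)`, `c̄̄ ∈ caᵐ⁺¹((R ⧸ (a)) ⧸ (b̄))` ⇒ `c ∈ caᵐ⁺³(R)` — the device that removes the hypothesis `2 ≠ 0`
from the chain's cA-ARENA FLOOR (stub-2's one-step quotient ascent p531707 applied twice along
`k[x,y,z]/(xy − h) ↠ k[x,z]/(x² − h) ↠ k[z]/(h)` needs `x̄ ∈ ca(k[x,z]/(x² − h))`, i.e. the Jacobian element `2x`;
res-L1-w44b-tri-2 TRIAGE v18 R68 «p = 2 `A_r` arrivals not covered»).  This file holds the homological lemmas of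
its proof:

## Contents

* §1 `smul_ext_X₁_eq_zero_of_shortExact_of_f_eq_smul` — LEMMA A (any `A`-linear abelian category): for a short
  exact `0 → X₁ —a•φ→ X₂ → X₃ → 0`, if `a` kills `Extⁱ(X₁, N)` and `c` kills `Extⁱ⁺¹(X₃, N)` then `c` kills
  `Extⁱ(X₁, N)`; `smul_ext_X₃_eq_zero_of_shortExact_of_projective'` — surjective dimension shifting.
* §2 `ext_smul_eq_zero_of_retract_sum` — `𝟙_L = p ≫ i + q ≫ j` through `N` and `K`, `r` kills `Extⁿ(N, −)`
  and `Extⁿ(K, −)` ⇒ `r` kills `Extⁿ(L, −)`.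
* §3 `shortExact_smul_of_surjective`, `exists_shortExact_smul_top` — the sequence `0 → N —a•𝟙→ N → N/aN → 0` in
  `ModuleCat R` for an `N`-regular `a` (with `N/aN` presented by any epimorphism with kernel `aN`);
  `smul_ext_eq_zero_of_smul_ext_quot_eq_zero`, `smul_ext_eq_zero_of_smul_ext_quotSMulTop_eq_zero` — LEMMA A for it.
* §4 `exists_retract_sum_isSyzygy_quotSMulTop` — Knörrer's lemma with the complement: `Ω(N/aN) ≅ N ⊕ ΩN`.

Consumers: part 2 (`…PersistenceQuotientAscentCodimTwo`), then `…PersistenceArenaFloorCharFree` (the arena floor and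
the `A_r` table in EVERY characteristic).

References (mechanism only): S. B. Iyengar, R. Takahashi, *Annihilation of cohomology and strong generation of
module categories*, IMRN 2016, arXiv:1404.1476, Remark 2.12 / 2.13, §2 [`IyengarTakahashi2014`]; H. Dao,
R. Takahashi, ANT 8 (2014) Lemma 5.6 [`DaoTakahashi2014`]; H. Knörrer, Invent. Math. 88 (1987) (the lemma
`Ω(N/aN) ≅ N ⊕ ΩN`).
-/

noncomputable section

-- single-problem summit: the doubled namespace component `ResolutionOfSingularities` is forced
set_option linter.dupNamespace false

namespace Summit.ResolutionOfSingularities.ResolutionOfSingularities.Theorems.HomologicalConductor.QuotientAscentCodimTwo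

open CategoryTheory CategoryTheory.Abelian CategoryTheory.Limits Literature.RingTheory.CohomologyAnnihilator
open Summit.ResolutionOfSingularities.ResolutionOfSingularities.Theorems.NoZeno.SandwichCluster
open Summit.ResolutionOfSingularities.ResolutionOfSingularities.Theorems.HomologicalConductor.QuotientHypersurfaceSaturation
open Summit.ResolutionOfSingularities.ResolutionOfSingularities.Theorems.HomologicalConductor.QuotientAscent
open scoped Pointwise nonZeroDivisors

universe w t v u

/-! ## §1 LEMMA A: a connecting map after a multiplication map -/

section Linear

variable {A : Type t} [Ring A] {C : Type u} [Category.{v} C] [Abelian C] [Linear A C] [HasExt.{w} C]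

/-- **LEMMA A.** Let `0 → X₁ —f→ X₂ → X₃ → 0` be short exact with `f = a • φ` for a scalar `a` and a morphism
`φ : X₁ ⟶ X₂`.  If `a` kills `Extⁱ(X₁, N)` and `c` kills `Extⁱ⁺¹(X₃, N)`, then `c` kills `Extⁱ(X₁, N)`: in the exact
`Extⁱ(X₂, N) —f*→ Extⁱ(X₁, N) —δ→ Extⁱ⁺¹(X₃, N)`, `δ(c • e) = c • δ e = 0`, so `c • e = f*(y) = a • (φ* y) = 0`.
(Typical use: `X₁ = X₂ = M`, `f = a • 𝟙`, `a` regular on `M` and killing `Extⁱ(M, N)` — then `δ` is injective.)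
[folklore; cite: IyengarTakahashi2014, Remark 2.3] -/
theorem smul_ext_X₁_eq_zero_of_shortExact_of_f_eq_smul {S : ShortComplex C} (hS : S.ShortExact) {a c : A}
    (φ : S.X₁ ⟶ S.X₂) (hf : S.f = a • φ) {N : C} {i : ℕ} (ha : ∀ e : Ext S.X₁ N i, a • e = 0)
    (hc : ∀ e : Ext S.X₃ N (i + 1), c • e = 0) (e : Ext S.X₁ N i) : c • e = 0 := by
  have hδ : hS.extClass.comp (c • e) (add_comm 1 i) = 0 := by
    rw [Ext.comp_smul]
    exact hc _
  obtain ⟨y, hy⟩ := Ext.contravariant_sequence_exact₁ hS N (c • e) (add_comm 1 i) hδ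
  rw [← hy, hf, Ext.mk₀_smul, Ext.smul_comp]
  exact ha _

/-- **Dimension shifting, surjective direction.** Let `0 → X₁ → X₂ → X₃ → 0` be short exact with `X₂`
projective.  If `c` kills `Extⁿ(X₁, N)` then `c` kills `Extⁿ⁺¹(X₃, N)`: the connecting map
`Extⁿ(X₁, N) → Extⁿ⁺¹(X₃, N)` is surjective (`Extⁿ⁺¹(X₂, N) = 0`) and linear. [folklore] -/
theorem smul_ext_X₃_eq_zero_of_shortExact_of_projective' {S : ShortComplex C} (hS : S.ShortExact)
    [Projective S.X₂] {N : C} {n : ℕ} {c : A} (hc : ∀ e : Ext S.X₁ N n, c • e = 0) (e : Ext S.X₃ N (n + 1)) :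
    c • e = 0 := by
  have h0 : (Ext.mk₀ S.g).comp e (zero_add (n + 1)) = 0 :=
    Ext.eq_zero_of_hasProjectiveDimensionLT _ 1 (by omega)
  obtain ⟨x₁, hx₁⟩ := Ext.contravariant_sequence_exact₃ hS N e h0 (add_comm 1 n)
  rw [← hx₁, ← Ext.comp_smul, hc, Ext.comp_zero]

/-! ## §2 Retract sums -/

/-- **Retract sum.** If `𝟙_L = p ≫ i + q ≫ j` for morphisms `L —p→ N —i→ L`, `L —q→ K —j→ L` (e.g.
`L ≅ N ⊕ K`), and `r` kills `Extⁿ(N, Y)` and `Extⁿ(K, Y)`, then `r` kills `Extⁿ(L, Y)`: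
`e = (mk₀ 𝟙).comp e = (mk₀ p).comp ((mk₀ i).comp e) + (mk₀ q).comp ((mk₀ j).comp e)`. [folklore] -/
theorem ext_smul_eq_zero_of_retract_sum {L N K Y : C} (i : N ⟶ L) (p : L ⟶ N) (j : K ⟶ L) (q : L ⟶ K)
    (h : p ≫ i + q ≫ j = 𝟙 L) {n : ℕ} (r : A) (hN : ∀ e : Ext N Y n, r • e = 0)
    (hK : ∀ e : Ext K Y n, r • e = 0) (e : Ext L Y n) : r • e = 0 := by
  have he : e = (Ext.mk₀ p).comp ((Ext.mk₀ i).comp e (zero_add n)) (zero_add n) +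
      (Ext.mk₀ q).comp ((Ext.mk₀ j).comp e (zero_add n)) (zero_add n) := by
    rw [Ext.mk₀_comp_mk₀_assoc, Ext.mk₀_comp_mk₀_assoc, ← Ext.add_comp, ← Ext.mk₀_add, h, Ext.mk₀_id_comp]
  have h₁ : r • (Ext.mk₀ i).comp e (zero_add n) = 0 := hN _
  have h₂ : r • (Ext.mk₀ j).comp e (zero_add n) = 0 := hK _
  rw [he, smul_add, ← Ext.comp_smul (Ext.mk₀ p), ← Ext.comp_smul (Ext.mk₀ q), h₁, h₂, Ext.comp_zero,
    Ext.comp_zero, add_zero]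

end Linear

/-! ## §3 The sequence `0 → N —a→ N → N/aN → 0` -/

section SMulTop

variable {R : Type u} [CommRing R]

/-- **The multiplication sequence, presented.** For `a ∈ R` regular on the `R`-module `N` and an epimorphism
`g : N ⟶ Q` in `ModuleCat R` with kernel `aN` (e.g. the quotient map onto `N ⧸ a • ⊤`, or onto a double quotient
carrying a restricted module structure) the sequence `0 → N —a • 𝟙→ N —g→ Q → 0` is short exact. [folklore] -/
theorem shortExact_smul_of_surjective {a : R} (N : ModuleCat.{u} R) (hreg : IsSMulRegular N a) (Q : ModuleCat.{u} R)
    (g : N ⟶ Q) (hg : Function.Surjective g) (hker : ∀ x : N, g x = 0 ↔ x ∈ (a • ⊤ : Submodule R N)) :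
    ∃ w : (a • 𝟙 N) ≫ g = 0, (ShortComplex.mk (a • 𝟙 N) g w).ShortExact := by
  let f : N →ₗ[R] N := a • LinearMap.id
  have hinj : Function.Injective f := fun x y hxy => hreg hxy
  have hex : Function.Exact f g.hom := by
    intro x
    change g x = 0 ↔ _
    rw [hker, Submodule.mem_smul_pointwise_iff_exists]
    constructor
    · rintro ⟨y, -, rfl⟩
      exact ⟨y, rfl⟩
    · rintro ⟨y, rfl⟩
      exact ⟨y, Submodule.mem_top, rfl⟩
  obtain ⟨w, hS⟩ := exists_shortExact_of_linearMap (Y := N) (M := N) (X := Q) f g.hom hinj hg hex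
  have hfeq : ModuleCat.ofHom f = a • 𝟙 N := by
    ext x
    rfl
  refine ⟨?_, ?_⟩
  · rw [← hfeq]; exact w
  · convert hS using 2
    all_goals first | exact hfeq.symm | rfl

/-- **The multiplication sequence** `0 → N —a • 𝟙→ N → N ⧸ a • ⊤ → 0` for `a` regular on `N`. [folklore] -/
theorem exists_shortExact_smul_top {a : R} (N : ModuleCat.{u} R) (hreg : IsSMulRegular N a) :
    ∃ (g : N ⟶ ModuleCat.of R (N ⧸ (a • ⊤ : Submodule R N))) (w : (a • 𝟙 N) ≫ g = 0),
      (ShortComplex.mk (a • 𝟙 N) g w).ShortExact ∧ ∀ x : N, g x = Submodule.Quotient.mk x := by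
  obtain ⟨w, hS⟩ := shortExact_smul_of_surjective N hreg (ModuleCat.of R (N ⧸ (a • ⊤ : Submodule R N)))
    (ModuleCat.ofHom (a • ⊤ : Submodule R N).mkQ) (Submodule.mkQ_surjective _)
    (fun x => by
      change (a • ⊤ : Submodule R N).mkQ x = 0 ↔ _
      rw [Submodule.mkQ_apply, Submodule.Quotient.mk_eq_zero])
  exact ⟨_, w, hS, fun x => rfl⟩

/-- **LEMMA A for the multiplication sequence, presented.** `a` regular on `N` and killing `Extⁱ_R(N, Y)`,
`g : N ↠ Q` with kernel `aN`; if `c` kills `Extⁱ⁺¹_R(Q, Y)` then `c` kills `Extⁱ_R(N, Y)` (the connecting map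
`Extⁱ(N, Y) → Extⁱ⁺¹(Q, Y)` is injective). [folklore] -/
theorem smul_ext_eq_zero_of_smul_ext_quot_eq_zero {a c : R} {N : ModuleCat.{u} R} (hreg : IsSMulRegular N a)
    {Q : ModuleCat.{u} R} (g : N ⟶ Q) (hg : Function.Surjective g)
    (hker : ∀ x : N, g x = 0 ↔ x ∈ (a • ⊤ : Submodule R N)) {Y : ModuleCat.{u} R} {i : ℕ}
    (ha : ∀ e : Ext.{u} N Y i, a • e = 0) (hc : ∀ e : Ext.{u} Q Y (i + 1), c • e = 0) (e : Ext.{u} N Y i) :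
    c • e = 0 := by
  obtain ⟨w, hS⟩ := shortExact_smul_of_surjective N hreg Q g hg hker
  exact smul_ext_X₁_eq_zero_of_shortExact_of_f_eq_smul hS (a := a) (𝟙 N) rfl ha hc e

/-- The case `Q = N ⧸ a • ⊤`. [folklore] -/
theorem smul_ext_eq_zero_of_smul_ext_quotSMulTop_eq_zero {a c : R} {N : ModuleCat.{u} R}
    (hreg : IsSMulRegular N a) {Y : ModuleCat.{u} R} {i : ℕ} (ha : ∀ e : Ext.{u} N Y i, a • e = 0)
    (hc : ∀ e : Ext.{u} (ModuleCat.of R (N ⧸ (a • ⊤ : Submodule R N))) Y (i + 1), c • e = 0)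
    (e : Ext.{u} N Y i) : c • e = 0 := by
  obtain ⟨g, w, hS, -⟩ := exists_shortExact_smul_top N hreg
  exact smul_ext_X₁_eq_zero_of_shortExact_of_f_eq_smul hS (a := a) (𝟙 N) rfl ha hc e

end SMulTop

/-! ## §4 Knörrer's lemma with the complement: `Ω_R(N/aN) ≅ N ⊕ Ω_R N` -/

section Knorrer

variable {R : Type u} [CommRing R]

/-- **Knörrer's lemma with the complement exposed** ([IyengarTakahashi2014, Remark 2.12]).  Let `N` be a
finitely generated module over a noetherian ring, `a ∈ R` regular on `N` and killing `Ext¹_R(N, Y)` for all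
finitely generated `Y`.  For a finite free cover `π : F ↠ N` with kernel `K = Ω N` (a first syzygy of `N`), the
module `L = π⁻¹(aN) = Ker(F → N/aN)` is a first syzygy of `N/aN`, and `L ≅ N ⊕ K`: there are
`N —i→ L —p→ N` and `K —j→ L —q→ K` with `p ≫ i + q ≫ j = 𝟙 L` (`i = ψ` a lift of `a • 𝟙_N` to `F`,
`p = a⁻¹ π`, `j` the inclusion, `q l = l − ψ(p l)`).  The tree's `exists_retract_isSyzygy_quotSMulTop` records only
the retract `i ≫ p = 𝟙`. [cite: IyengarTakahashi2014, Remark 2.12] -/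
theorem exists_retract_sum_isSyzygy_quotSMulTop [IsNoetherianRing R] {a : R} {N : ModuleCat.{u} R}
    [Module.Finite R N] (hreg : IsSMulRegular N a)
    (hN : ∀ Y : ModuleCat.{u} R, Module.Finite R Y → ∀ e : Abelian.Ext.{u} N Y 1, a • e = 0) :
    ∃ L K : ModuleCat.{u} R, IsSyzygy 1 (ModuleCat.of R (N ⧸ (a • ⊤ : Submodule R N))) L ∧ IsSyzygy 1 N K ∧
      ∃ (i : N ⟶ L) (p : L ⟶ N) (j : K ⟶ L) (q : L ⟶ K), p ≫ i + q ≫ j = 𝟙 L := by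
  -- a finite free cover and the lift of `a · 𝟙`
  obtain ⟨n, π, hπ⟩ := Module.Finite.exists_fin' R N
  let F := ModuleCat.of R (Fin n → R)
  have hT := LinearMap.shortExact_shortComplexKer hπ
  haveI : Module.Finite R (LinearMap.ker π) := Module.IsNoetherian.finite R _
  have hclass : a • hT.extClass = 0 := hN (ModuleCat.of R (LinearMap.ker π)) inferInstance _
  obtain ⟨ψ, hψ⟩ := exists_comp_eq_smul_id_X₃_of_smul_extClass_eq_zero hT hclass
  have hψ' : ∀ x : N, π (ψ.hom x) = a • x := fun x => by
    have := congrArg (fun φ => φ.hom x) hψ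
    simpa using this
  -- `L = Ker(F → N/aN)`
  let ρ : (Fin n → R) →ₗ[R] N ⧸ (a • ⊤ : Submodule R N) := (a • ⊤ : Submodule R N).mkQ ∘ₗ π
  have hρ : Function.Surjective ρ := (Submodule.mkQ_surjective _).comp hπ
  let L := LinearMap.ker ρ
  obtain ⟨wL, hSL⟩ := exists_shortExact_of_linearMap (Y := ModuleCat.of R L) (M := F)
    (X := ModuleCat.of R (N ⧸ (a • ⊤ : Submodule R N))) L.subtype ρ Subtype.val_injective hρ
    (LinearMap.exact_subtype_ker_map ρ)
  have hL : IsSyzygy 1 (ModuleCat.of R (N ⧸ (a • ⊤ : Submodule R N))) (ModuleCat.of R L) :=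
    isSyzygy_one_iff.mpr ⟨F, inferInstance,
      (IsProjective.iff_projective (R := R) (Fin n → R)).mp inferInstance, _, _, wL, hSL⟩
  -- `K = Ker π = Ω N`
  let K := LinearMap.ker π
  have hK : IsSyzygy 1 N (ModuleCat.of R K) :=
    isSyzygy_one_iff.mpr ⟨F, inferInstance,
      (IsProjective.iff_projective (R := R) (Fin n → R)).mp inferInstance,
      ModuleCat.ofHom K.subtype, ModuleCat.ofHom π, by ext x; exact x.2, hT⟩
  -- `i : N → L`, `x ↦ ψ x`
  have hmemL : ∀ x : N, ψ.hom x ∈ L := fun x => by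
    change (a • ⊤ : Submodule R N).mkQ (π (ψ.hom x)) = 0
    rw [hψ', Submodule.mkQ_apply, Submodule.Quotient.mk_eq_zero]
    exact Submodule.smul_mem_pointwise_smul _ _ _ trivial
  let i : N →ₗ[R] L := LinearMap.codRestrict L ψ.hom hmemL
  -- `p : L → N`, `l ↦ a⁻¹ π l`
  let ma : N →ₗ[R] N := LinearMap.lsmul R N a
  have hma : Function.Injective ma := hreg
  have hrange : ∀ l : L, π l.1 ∈ LinearMap.range ma := fun l => by
    have hl : ρ l.1 = 0 := l.2
    change (a • ⊤ : Submodule R N).mkQ (π l.1) = 0 at hl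
    rw [Submodule.mkQ_apply, Submodule.Quotient.mk_eq_zero] at hl
    obtain ⟨y, -, hy⟩ := (Submodule.mem_smul_pointwise_iff_exists _ _ _).1 hl
    exact ⟨y, hy⟩
  let p : L →ₗ[R] N := (LinearEquiv.ofInjective ma hma).symm.toLinearMap ∘ₗ
    LinearMap.codRestrict (LinearMap.range ma) (π ∘ₗ L.subtype) hrange
  have hp : ∀ l : L, a • p l = π l.1 := fun l => by
    have h := congrArg Subtype.val ((LinearEquiv.ofInjective ma hma).apply_symm_apply
      ⟨π l.1, hrange l⟩)
    rw [LinearEquiv.ofInjective_apply] at h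
    exact h
  -- `j : K → L` the inclusion (`Ker π ⊆ Ker ρ`), `q : L → K`, `l ↦ l − ψ (p l)`
  have hKL : K ≤ L := fun x hx => by
    change (a • ⊤ : Submodule R N).mkQ (π x) = 0
    rw [show π x = 0 from hx, map_zero]
  let j : K →ₗ[R] L := Submodule.inclusion hKL
  have hmemK : ∀ l : L, (L.subtype - ψ.hom ∘ₗ p) l ∈ K := fun l => by
    change π (l.1 - ψ.hom (p l)) = 0
    rw [map_sub, hψ', hp, sub_self]
  let q : L →ₗ[R] K := LinearMap.codRestrict K (L.subtype - ψ.hom ∘ₗ p) hmemK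
  refine ⟨ModuleCat.of R L, ModuleCat.of R K, hL, hK, ModuleCat.ofHom i, ModuleCat.ofHom p, ModuleCat.ofHom j,
    ModuleCat.ofHom q, ?_⟩
  apply ModuleCat.hom_ext
  refine LinearMap.ext fun l => Subtype.ext ?_
  simp only [ModuleCat.hom_add, ModuleCat.hom_comp, ModuleCat.hom_ofHom, ModuleCat.hom_id, LinearMap.add_apply,
    LinearMap.comp_apply, LinearMap.id_apply, Submodule.coe_add]
  change ψ.hom (p l) + (l.1 - ψ.hom (p l)) = l.1
  abel

end Knorrer

end Summit.ResolutionOfSingularities.ResolutionOfSingularities.Theorems.HomologicalConductor.QuotientAscentCodimTwo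

end
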